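import Mathlib.LinearAlgebra.Matrix.FixedDetMatrices
import Mathlib.Algebra.BigOperators.Finprod
import Mathlib.Tactic
import HarnessLib

/-!
# Popa–Zagier Hecke elements: `Γ_∞`-orbit sums of `(1 - S) ξ` from property (B)
# (the descent of [PopaZagier2017, Thm. 1], specialised to elements with property (B))

Source: A. A. Popa, D. Zagier, *An elementary proof of the Eichler–Selberg trace formula*,
J. reine angew. Math. **762** (2020) = arXiv:1711.00327 [PopaZagier2017], §3, proof of Thm. 1
(held: `paper:arxiv-1711.00327`, chunks 6–7).

Let `ξ = ∑ ξ(M) M ∈ ℚ[M_n]` be a finitely supported EVEN function on integral `2 × 2` matrices of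
determinant `n > 0` (an element of `R_n = ℚ[M_n]`, `M_n` = matrices modulo `±1`), and suppose `ξ`
has Popa–Zagier's property (B) in the coefficientwise form of `PopaZagierHeckeElement`:
`e = ξ + ξ(·S)` is invariant under `M ↦ UM` and `f = ξ + ξ(·U) + ξ(·U²)` under `M ↦ SM`
(`S = (0 -1; 1 0)`, `U = (1 -1; 1 0) = TS`, `T = (1 1; 0 1)`). Property (A) — "`ξ` acts as the
Hecke operator `T_n` on period polynomials / modular symbols" — reads
`(1 - S) ξ - T_n^∞ (1 - S) ∈ (1 - T) R_n`, and an element of `R_n` lies in `(1 - T) R_n` iff its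
sums over all `Γ_∞ = ⟨T⟩`-orbits `{T^k M}` vanish (loc. cit. (5)). This file proves the orbit-sum
form of (A) from (B) and ONE explicit evaluation, following the descent in the proof of
loc. cit. Thm. 1:

* `orbT ζ M = ∑_{k ∈ ℤ} ζ(T^k M)` (`Γ_∞`-orbit sums; `finsum`), with the telescoping, shift,
  evenness and additivity lemmas;
* `HeckeHyp n ξ` — the hypotheses (even, finitely supported on `det = n`, (B1), (B2));
* `orbT_zeta0_add_mul_S`, `orbT_zeta0_three_term` — **Step 1**: for `a(M) = ∑_k ζ₀(T^k M)`,
  `ζ₀ = (1 - S)ξ` (i.e. `ζ₀(M) = ξ(M) - ξ(SM)`), property (B) gives `a(M) + a(MS) = 0` and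
  `a(M) + a(MU) + a(MU²) = 0` (loc. cit.: `(1 - S) ξ π_S, (1 - S) ξ π_U ∈ (1 - T)R`, using
  `(1 - S) π_U = (1 - T⁻¹) π_U`);
* `orbT_zeta0_eq_zero_of_ne` — **Step 2** (the descent "as in the proof of Lemma 2"): `a(M) = 0`
  unless the bottom row of `M` has a zero entry (the relation `a(M) = a(MSU) + a(MSU²)` moves
  the bottom row `(c, d)` to rows of larger `|c| + |d|`, contradicting finite support);
* `orbT_zeta0_eq` — **conclusion**: if moreover `a(H) = 1` for every upper triangular `H` of
  determinant `n` with positive diagonal, then for every `M` of determinant `n`,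
  `a(M) = 𝟙[c = 0] - 𝟙[d = 0]`, which is exactly the orbit-sum function of `T_n^∞(1 - S)`
  (`T_n^∞ = ∑` of the upper triangular Hermite representatives): property (A) for `ξ`.

For the explicit element of `PopaZagierHeckeElement` the remaining evaluation `a(H) = 1` is a
two-term computation (companion file `PopaZagierHeckeElementPropertyA`), which replaces the route
of loc. cit. through Thm. 2 and Thm. 4(b) (`β = -1 ⇒ α = 1`).

## References

* [PopaZagier2017] A. A. Popa, D. Zagier, J. reine angew. Math. 762 (2020), §3: (5), Lemma 2,
  Thm. 1 and its proof.
-/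

namespace Literature.NumberTheory.Automorphic.PopaZagier

open Matrix

/-! ### Integral `2 × 2` matrices, `S`, `U`, `T^k` -/

/-- Integral `2 × 2` matrices. [folklore] -/
abbrev Mat : Type := Matrix (Fin 2) (Fin 2) ℤ

/-- `S = (0 -1; 1 0)`. [cite: PopaZagier2017, §1] -/
def matS : Mat := !![0, -1; 1, 0]

/-- `U = (1 -1; 1 0)` (`= TS` up to sign; order `3` in `PSL₂(ℤ)`). [cite: PopaZagier2017, §1] -/
def matU : Mat := !![1, -1; 1, 0]

/-- `T^k = (1 k; 0 1)`. [cite: PopaZagier2017, §1] -/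
def matT (k : ℤ) : Mat := !![1, k; 0, 1]

/-- Entry of `matS`. [folklore] -/
@[simp] theorem matS_apply00 : matS 0 0 = 0 := rfl
/-- Entry of `matS`. [folklore] -/
@[simp] theorem matS_apply01 : matS 0 1 = -1 := rfl
/-- Entry of `matS`. [folklore] -/
@[simp] theorem matS_apply10 : matS 1 0 = 1 := rfl
/-- Entry of `matS`. [folklore] -/
@[simp] theorem matS_apply11 : matS 1 1 = 0 := rfl
/-- Entry of `matU`. [folklore] -/
@[simp] theorem matU_apply00 : matU 0 0 = 1 := rfl
/-- Entry of `matU`. [folklore] -/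
@[simp] theorem matU_apply01 : matU 0 1 = -1 := rfl
/-- Entry of `matU`. [folklore] -/
@[simp] theorem matU_apply10 : matU 1 0 = 1 := rfl
/-- Entry of `matU`. [folklore] -/
@[simp] theorem matU_apply11 : matU 1 1 = 0 := rfl
/-- Entry of `matT`. [folklore] -/
@[simp] theorem matT_apply00 (k : ℤ) : matT k 0 0 = 1 := rfl
/-- Entry of `matT`. [folklore] -/
@[simp] theorem matT_apply01 (k : ℤ) : matT k 0 1 = k := rfl
/-- Entry of `matT`. [folklore] -/
@[simp] theorem matT_apply10 (k : ℤ) : matT k 1 0 = 0 := rfl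
/-- Entry of `matT`. [folklore] -/
@[simp] theorem matT_apply11 (k : ℤ) : matT k 1 1 = 1 := rfl

/-- Entries of a product of `2 × 2` matrices. [folklore] -/
theorem mul_apply_two (A B : Mat) (i j : Fin 2) : (A * B) i j = A i 0 * B 0 j + A i 1 * B 1 j := by
  rw [Matrix.mul_apply, Fin.sum_univ_two]

/-- `T^j T^k = T^{j+k}`. [folklore] -/
theorem matT_mul_matT (j k : ℤ) : matT j * matT k = matT (j + k) := by
  simp only [matT, Matrix.mul_fin_two]
  ext i j'
  fin_cases i <;> fin_cases j' <;> simp [add_comm]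

/-- `T^0 = 1`. [folklore] -/
@[simp] theorem matT_zero : matT 0 = 1 := by
  ext i j
  fin_cases i <;> fin_cases j <;> rfl

/-- `det T^k = 1`. [folklore] -/
@[simp] theorem det_matT (k : ℤ) : (matT k).det = 1 := by
  simp [matT, Matrix.det_fin_two_of]

/-- `det S = 1`. [folklore] -/
@[simp] theorem det_matS : matS.det = 1 := by
  simp [matS, Matrix.det_fin_two_of]

/-- `det U = 1`. [folklore] -/
@[simp] theorem det_matU : matU.det = 1 := by
  simp [matU, Matrix.det_fin_two_of]

/-- `U S = -T`. [folklore] -/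
theorem matU_mul_matS : matU * matS = -matT 1 := by
  ext i j
  fin_cases i <;> fin_cases j <;> simp [mul_apply_two]

/-- `T S U U = -1` (i.e. `S U² = -T⁻¹`). [folklore] -/
theorem matT_mul_matS_mul_matU_mul_matU : matT 1 * matS * matU * matU = -1 := by
  ext i j
  fin_cases i <;> fin_cases j <;> simp [mul_apply_two]

/-- `S S = -1`. [folklore] -/
theorem matS_mul_matS : matS * matS = -1 := by
  ext i j
  fin_cases i <;> fin_cases j <;> simp [mul_apply_two]

/-- The bottom row of `T^k M` is that of `M`; the top row is shifted. [folklore] -/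
theorem matT_mul_apply (k : ℤ) (M : Mat) :
    (matT k * M) 0 0 = M 0 0 + k * M 1 0 ∧ (matT k * M) 0 1 = M 0 1 + k * M 1 1 ∧
    (matT k * M) 1 0 = M 1 0 ∧ (matT k * M) 1 1 = M 1 1 := by
  refine ⟨?_, ?_, ?_, ?_⟩ <;> simp [mul_apply_two]

/-- `k ↦ T^k M` is injective as soon as the bottom row of `M` is non-zero. [folklore] -/
theorem matT_mul_injective {M : Mat} (hM : M 1 0 ≠ 0 ∨ M 1 1 ≠ 0) :
    Function.Injective fun k : ℤ => matT k * M := by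
  intro j k hjk
  have h0 := congrFun (congrFun hjk 0) 0
  have h1 := congrFun (congrFun hjk 0) 1
  simp only [(matT_mul_apply j M).1, (matT_mul_apply k M).1, (matT_mul_apply j M).2.1,
    (matT_mul_apply k M).2.1, add_right_inj] at h0 h1
  rcases hM with h | h
  · exact mul_right_cancel₀ h h0
  · exact mul_right_cancel₀ h h1

/-- A matrix of non-zero determinant has a non-zero bottom row. [folklore] -/
theorem row_ne_zero_of_det_ne_zero {M : Mat} (hM : M.det ≠ 0) : M 1 0 ≠ 0 ∨ M 1 1 ≠ 0 := by
  by_contra h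
  push Not at h
  apply hM
  rw [Matrix.det_fin_two, h.1, h.2]
  ring

/-! ### `Γ_∞`-orbit sums -/

/-- The sum of `ζ` over the `Γ_∞ = ⟨T⟩`-orbit of `M`: `∑_{k ∈ ℤ} ζ(T^k M)` (a finite sum for
finitely supported `ζ` and `M` with non-zero bottom row; `finsum`). [cite: PopaZagier2017, §3 (5)] -/
noncomputable def orbT (ζ : Mat → ℚ) (M : Mat) : ℚ := ∑ᶠ k : ℤ, ζ (matT k * M)

/-- Finiteness of the orbit slice of a finitely supported function. [folklore] -/
theorem finite_support_orbit {ζ : Mat → ℚ} (hfin : (Function.support ζ).Finite) {M : Mat}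
    (hM : M 1 0 ≠ 0 ∨ M 1 1 ≠ 0) : (Function.support fun k : ℤ => ζ (matT k * M)).Finite := by
  have : (Function.support fun k : ℤ => ζ (matT k * M)) = (fun k : ℤ => matT k * M) ⁻¹' Function.support ζ := by
    ext k; simp
  rw [this]
  exact hfin.preimage ((matT_mul_injective hM).injOn)

/-- Shift invariance: `∑_k ζ(T^k T^j M) = ∑_k ζ(T^k M)`. [folklore] -/
theorem orbT_matT_mul (ζ : Mat → ℚ) (j : ℤ) (M : Mat) : orbT ζ (matT j * M) = orbT ζ M := by
  unfold orbT
  have h : (fun k : ℤ => ζ (matT k * (matT j * M))) =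
      fun k => (fun k' : ℤ => ζ (matT k' * M)) (Equiv.addRight j k) := by
    funext k
    simp only [Equiv.coe_addRight, ← Matrix.mul_assoc, matT_mul_matT]
  rw [h]
  exact finsum_comp_equiv (Equiv.addRight j) (f := fun k' : ℤ => ζ (matT k' * M))

/-- Additivity of orbit sums (finite supports). [folklore] -/
theorem orbT_add {ζ₁ ζ₂ : Mat → ℚ} (h₁ : (Function.support ζ₁).Finite)
    (h₂ : (Function.support ζ₂).Finite) {M : Mat} (hM : M 1 0 ≠ 0 ∨ M 1 1 ≠ 0) :
    orbT (fun X => ζ₁ X + ζ₂ X) M = orbT ζ₁ M + orbT ζ₂ M := by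
  unfold orbT
  exact finsum_add_distrib (finite_support_orbit h₁ hM) (finite_support_orbit h₂ hM)

/-- Subtractivity of orbit sums (finite supports). [folklore] -/
theorem orbT_sub {ζ₁ ζ₂ : Mat → ℚ} (h₁ : (Function.support ζ₁).Finite)
    (h₂ : (Function.support ζ₂).Finite) {M : Mat} (hM : M 1 0 ≠ 0 ∨ M 1 1 ≠ 0) :
    orbT (fun X => ζ₁ X - ζ₂ X) M = orbT ζ₁ M - orbT ζ₂ M := by
  unfold orbT
  exact finsum_sub_distrib (finite_support_orbit h₁ hM) (finite_support_orbit h₂ hM)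

/-- Orbit sums of a pointwise-equal function. [folklore] -/
theorem orbT_congr {ζ₁ ζ₂ : Mat → ℚ} (h : ∀ X, ζ₁ X = ζ₂ X) (M : Mat) : orbT ζ₁ M = orbT ζ₂ M := by
  unfold orbT
  exact finsum_congr fun k => h _

/-- The orbit sum of a right translate: `∑_k ζ(T^k M g) `. [folklore] -/
theorem orbT_mul_right (ζ : Mat → ℚ) (g M : Mat) : orbT (fun X => ζ (X * g)) M = orbT ζ (M * g) := by
  unfold orbT
  simp_rw [Matrix.mul_assoc]

/-- Evenness passes to orbit sums: `∑_k ζ(T^k (-M)) = ∑_k ζ(T^k M)`. [folklore] -/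
theorem orbT_neg {ζ : Mat → ℚ} (heven : ∀ X, ζ (-X) = ζ X) (M : Mat) : orbT ζ (-M) = orbT ζ M := by
  unfold orbT
  simp_rw [Matrix.mul_neg, heven]

/-- **Telescoping**: the orbit sums of `X ↦ w(X) - w(T^j X)` vanish (`(1 - T^{-j}) w ∈ (1 - T)R`
has vanishing `Γ_∞`-orbit sums, [PopaZagier2017] (5), easy direction). [cite: PopaZagier2017, §3 (5)] -/
theorem orbT_sub_shift_eq_zero {w : Mat → ℚ} (hfin : (Function.support w).Finite) (j : ℤ) {M : Mat}
    (hM : M 1 0 ≠ 0 ∨ M 1 1 ≠ 0) : orbT (fun X => w X - w (matT j * X)) M = 0 := by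
  have h2 : (Function.support fun X => w (matT j * X)).Finite := by
    have : (Function.support fun X => w (matT j * X)) = (fun X => matT j * X) ⁻¹' Function.support w := by
      ext X; simp
    rw [this]
    refine hfin.preimage (Set.injOn_of_injective ?_)
    intro X Y hXY
    have := congrArg (fun Z => matT (-j) * Z) hXY
    simpa [← Matrix.mul_assoc, matT_mul_matT] using this
  rw [orbT_sub hfin h2 hM, sub_eq_zero]
  -- `∑_k w(T^j T^k M) = ∑_k w(T^{k} M)` by the shift `k ↦ k + j`
  unfold orbT
  have h : (fun k : ℤ => w (matT j * (matT k * M))) =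
      fun k => (fun k' : ℤ => w (matT k' * M)) (Equiv.addLeft j k) := by
    funext k
    simp only [Equiv.coe_addLeft, ← Matrix.mul_assoc, matT_mul_matT]
  rw [h]
  exact (finsum_comp_equiv (Equiv.addLeft j) (f := fun k' : ℤ => w (matT k' * M))).symm

/-- If an orbit sum is non-zero, the orbit meets the support. [folklore] -/
theorem exists_ne_zero_of_orbT_ne_zero {ζ : Mat → ℚ} {M : Mat} (h : orbT ζ M ≠ 0) :
    ∃ k : ℤ, ζ (matT k * M) ≠ 0 := by
  by_contra hk
  push Not at hk
  exact h (finsum_eq_zero_of_forall_eq_zero hk)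

/-- The support of `ζ ∘ φ` is finite for finitely supported `ζ` and injective `φ`. [folklore] -/
theorem finite_support_comp {ζ : Mat → ℚ} (hfin : (Function.support ζ).Finite) {φ : Mat → Mat}
    (hφ : Function.Injective φ) : (Function.support fun X => ζ (φ X)).Finite := by
  have : (Function.support fun X => ζ (φ X)) = φ ⁻¹' Function.support ζ := by
    ext X; simp
  rw [this]
  exact hfin.preimage hφ.injOn

/-- Left multiplication by a matrix of unit determinant is injective. [folklore] -/
theorem mul_left_injective_of_isUnit {g : Mat} (hg : IsUnit g.det) :
    Function.Injective fun X : Mat => g * X :=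
  fun _ _ hXY => ((Matrix.isUnit_iff_isUnit_det g).mpr hg).mul_left_cancel hXY

/-- Right multiplication by a matrix of unit determinant is injective. [folklore] -/
theorem mul_right_injective_of_isUnit {g : Mat} (hg : IsUnit g.det) :
    Function.Injective fun X : Mat => X * g :=
  fun _ _ hXY => ((Matrix.isUnit_iff_isUnit_det g).mpr hg).mul_right_cancel hXY

/-! ### The hypotheses: an even element of `ℚ[M_n]` with property (B) -/

/-- `ζ₀ = (1 - S) ξ` as a function: the coefficient of `M` in `(1 - S)ξ` is `ξ(M) - ξ(S⁻¹ M) =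
ξ(M) - ξ(S M)` for even `ξ` (`S⁻¹ = -S`). [cite: PopaZagier2017, §3 proof of Thm. 1 ("ξ = (1-S)T")] -/
def zeta0 (ξ : Mat → ℚ) (M : Mat) : ℚ := ξ M - ξ (matS * M)

/-- The hypotheses of this file on `ξ ∈ ℚ[M_n]`: `ξ` is even (a function on matrices modulo
`±1`), finitely supported on matrices of determinant `n`, and has Popa–Zagier's property (B)
coefficientwise: `ξ + ξ(·S)` is left-`U`-invariant (`ξ(1 + S) ∈ (1 + U + U²)R_n`) and
`ξ + ξ(·U) + ξ(·U²)` is left-`S`-invariant (`ξ(1 + U + U²) ∈ (1 + S)R_n`).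
[cite: PopaZagier2017, §1 (B)] -/
structure HeckeHyp (n : ℤ) (ξ : Mat → ℚ) : Prop where
  even : ∀ M, ξ (-M) = ξ M
  finite : (Function.support ξ).Finite
  det_eq : ∀ M, ξ M ≠ 0 → M.det = n
  propB1 : ∀ M, ξ M + ξ (M * matS) = ξ (matU * M) + ξ (matU * M * matS)
  propB2 : ∀ M, ξ M + ξ (M * matU) + ξ (M * matU * matU) =
    ξ (matS * M) + ξ (matS * M * matU) + ξ (matS * M * matU * matU)

namespace HeckeHyp

variable {n : ℤ} {ξ : Mat → ℚ}

/-- `ζ₀ = (1 - S)ξ` is finitely supported. [folklore] -/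
theorem finite_support_zeta0 (h : HeckeHyp n ξ) : (Function.support (zeta0 ξ)).Finite := by
  refine (h.finite.union (finite_support_comp h.finite (mul_left_injective_of_isUnit (g := matS) (by simp)))).subset ?_
  intro X hX
  simp only [Function.mem_support, zeta0] at hX
  by_contra hX'
  simp only [Set.mem_union, Function.mem_support, not_or, not_not] at hX'
  exact hX (by rw [hX'.1, hX'.2, sub_zero])

/-- `ζ₀` is even. [folklore] -/
theorem zeta0_neg (h : HeckeHyp n ξ) (M : Mat) : zeta0 ξ (-M) = zeta0 ξ M := by
  simp [zeta0, h.even]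

/-! ### Step 1: property (B) gives the two relations on `a(M) = ∑_k ζ₀(T^k M)` -/

/-- **Step 1a** (`(1 - S) ξ π_S ∈ (1 - T) R`): `a(M) + a(MS) = 0` for `M` of non-zero determinant.
Proof: `ζ₀ + ζ₀(·S) = e - e(S·)` with `e = ξ + ξ(·S)` left-`U`-invariant, so `e(SX) = e(USX) =
e(-TX) = e(TX)` and the orbit sums telescope. [cite: PopaZagier2017, §3 proof of Thm. 1 (4)] -/
theorem orbT_zeta0_add_mul_S (h : HeckeHyp n ξ) {M : Mat} (hM : M.det ≠ 0) :
    orbT (zeta0 ξ) M + orbT (zeta0 ξ) (M * matS) = 0 := by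
  have hrow := row_ne_zero_of_det_ne_zero hM
  set e : Mat → ℚ := fun X => ξ X + ξ (X * matS) with he
  have hefin : (Function.support e).Finite := by
    refine (h.finite.union (finite_support_comp h.finite (mul_right_injective_of_isUnit (g := matS) (by simp)))).subset ?_
    intro X hX
    simp only [Function.mem_support, he] at hX
    by_contra hX'
    simp only [Set.mem_union, Function.mem_support, not_or, not_not] at hX'
    exact hX (by rw [hX'.1, hX'.2, add_zero])
  -- pointwise identity `ζ₀ X + ζ₀ (X S) = e X - e (T X)`
  have hpt : ∀ X : Mat, zeta0 ξ X + zeta0 ξ (X * matS) = e X - e (matT 1 * X) := by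
    intro X
    have h1 : e (matS * X) = e (matT 1 * X) := by
      have hU := h.propB1 (matS * X)
      -- `e (S X) = e (U S X)` and `U S = -T`
      have : e (matS * X) = e (matU * (matS * X)) := by
        simp only [he]
        rw [hU, Matrix.mul_assoc]
      rw [this, ← Matrix.mul_assoc, matU_mul_matS, Matrix.neg_mul]
      simp only [he, Matrix.neg_mul, h.even]
    simp only [zeta0, he, Matrix.mul_assoc] at h1 ⊢
    linear_combination -h1
  rw [← orbT_mul_right (zeta0 ξ) matS M,
    ← orbT_add h.finite_support_zeta0 ?_ hrow, orbT_congr hpt]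
  · exact orbT_sub_shift_eq_zero hefin 1 hrow
  · exact finite_support_comp h.finite_support_zeta0 (mul_right_injective_of_isUnit (g := matS) (by simp))

/-- **Step 1b** (`(1 - S) ξ π_U = 0`): `a(M) + a(MU) + a(MU²) = 0`. Proof:
`ζ₀ + ζ₀(·U) + ζ₀(·U²) = f - f(S·) = 0` with `f = ξ + ξ(·U) + ξ(·U²)` left-`S`-invariant.
[cite: PopaZagier2017, §3 proof of Thm. 1 (4)] -/
theorem orbT_zeta0_three_term (h : HeckeHyp n ξ) {M : Mat} (hM : M.det ≠ 0) :
    orbT (zeta0 ξ) M + orbT (zeta0 ξ) (M * matU) + orbT (zeta0 ξ) (M * matU * matU) = 0 := by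
  have hrow := row_ne_zero_of_det_ne_zero hM
  have hpt : ∀ X : Mat, zeta0 ξ X + zeta0 ξ (X * matU) + zeta0 ξ (X * matU * matU) = 0 := by
    intro X
    have hB := h.propB2 X
    simp only [zeta0, Matrix.mul_assoc] at hB ⊢
    linear_combination hB
  have hU : IsUnit matU.det := by simp
  have hf1 := finite_support_comp h.finite_support_zeta0 (mul_right_injective_of_isUnit hU)
  have hf2 := finite_support_comp hf1 (mul_right_injective_of_isUnit hU)
  rw [← orbT_mul_right (zeta0 ξ) matU M, ← orbT_mul_right (zeta0 ξ) matU (M * matU),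
    ← orbT_mul_right (fun X => zeta0 ξ (X * matU)) matU M,
    ← orbT_add h.finite_support_zeta0 hf1 hrow, ← orbT_add (h.finite_support_zeta0.union hf1 |>.subset ?_) hf2 hrow]
  · rw [orbT_congr (ζ₂ := fun _ => 0) (fun X => by simpa using hpt X)]
    simp [orbT]
  · intro X hX
    simp only [Function.mem_support, ne_eq] at hX
    by_contra h'
    simp only [Set.mem_union, Function.mem_support, not_or, not_not] at h'
    exact hX (by rw [h'.1, h'.2, add_zero])

/-! ### Step 2: the descent — `a(M) = 0` unless the bottom row of `M` has a zero entry -/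

/-- The size `|c| + |d|` of the bottom row `(c, d)` of `M`; invariant along `Γ_∞`-orbits.
[cite: PopaZagier2017, proof of Lemma 2 ("the sum of the entries increases strictly")] -/
def rowSize (M : Mat) : ℕ := (M 1 0).natAbs + (M 1 1).natAbs

/-- `rowSize` is constant on `Γ_∞`-orbits. [folklore] -/
theorem rowSize_matT_mul (k : ℤ) (M : Mat) : rowSize (matT k * M) = rowSize M := by
  simp only [rowSize, (matT_mul_apply k M).2.2.1, (matT_mul_apply k M).2.2.2]

/-- Bottom rows of `MSU`, `MSU²`, `MT`, `MTSU` in terms of the bottom row `(c, d)` of `M`: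
`(d - c, -d)`, `(-c, c - d)`, `(c, c + d)`, `(d, -c - d)`. [folklore] -/
theorem rows_of_moves (M : Mat) :
    (M * matS * matU) 1 0 = M 1 1 - M 1 0 ∧ (M * matS * matU) 1 1 = -M 1 1 ∧
    (M * matS * matU * matU) 1 0 = -M 1 0 ∧ (M * matS * matU * matU) 1 1 = M 1 0 - M 1 1 ∧
    (M * matT 1) 1 0 = M 1 0 ∧ (M * matT 1) 1 1 = M 1 0 + M 1 1 ∧
    (M * matT 1 * matS * matU) 1 0 = M 1 1 ∧ (M * matT 1 * matS * matU) 1 1 = -M 1 0 - M 1 1 := by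
  refine ⟨?_, ?_, ?_, ?_, ?_, ?_, ?_, ?_⟩ <;> simp [mul_apply_two] <;> ring

/-- A uniform bound: if `a(M) ≠ 0` then `rowSize M` is at most the largest row size in the
(finite) support of `ζ₀`. [cite: PopaZagier2017, proof of Lemma 2] -/
theorem exists_rowSize_le (h : HeckeHyp n ξ) :
    ∃ B : ℕ, ∀ M : Mat, orbT (zeta0 ξ) M ≠ 0 → rowSize M ≤ B := by
  have hfin := h.finite_support_zeta0
  refine ⟨hfin.toFinset.sup rowSize, fun M hM => ?_⟩
  obtain ⟨k, hk⟩ := exists_ne_zero_of_orbT_ne_zero hM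
  have hmem : matT k * M ∈ hfin.toFinset := by simpa using hk
  calc rowSize M = rowSize (matT k * M) := (rowSize_matT_mul k M).symm
    _ ≤ hfin.toFinset.sup rowSize := Finset.le_sup hmem

/-- Relation (R): `a(M) = a(MSU) + a(MSU²)` (from `a(M) = -a(MS)` and the three-term relation at
`MS`). [cite: PopaZagier2017, §3 proof of Thm. 1 ("It follows that a(K) = a(KT) + a(KT')")] -/
theorem orbT_zeta0_rel (h : HeckeHyp n ξ) {M : Mat} (hM : M.det ≠ 0) :
    orbT (zeta0 ξ) M =
      orbT (zeta0 ξ) (M * matS * matU) + orbT (zeta0 ξ) (M * matS * matU * matU) := by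
  have h1 := h.orbT_zeta0_add_mul_S hM
  have h2 := h.orbT_zeta0_three_term (M := M * matS) (by simpa [Matrix.det_mul] using hM)
  linear_combination h1 - h2

/-- Relation (R'): `a(M) = a(MT) - a(MTSU)` ((R) at `MT`, using `T S U² = -1` and evenness).
[cite: PopaZagier2017, §3 proof of Thm. 1] -/
theorem orbT_zeta0_rel' (h : HeckeHyp n ξ) {M : Mat} (hM : M.det ≠ 0) :
    orbT (zeta0 ξ) M = orbT (zeta0 ξ) (M * matT 1) - orbT (zeta0 ξ) (M * matT 1 * matS * matU) := by
  have h3 := h.orbT_zeta0_rel (M := M * matT 1) (by simpa [Matrix.det_mul] using hM)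
  have e : M * matT 1 * matS * matU * matU = -M := by
    rw [show M * matT 1 * matS * matU * matU = M * (matT 1 * matS * matU * matU) by
      simp only [Matrix.mul_assoc], matT_mul_matS_mul_matU_mul_matU, Matrix.mul_neg, Matrix.mul_one]
  rw [e, orbT_neg h.zeta0_neg] at h3
  linear_combination -h3

/-- If a sum of two rationals is non-zero, one of them is. [folklore] -/
private theorem ne_zero_or_of_add_ne_zero {x y : ℚ} (hxy : x + y ≠ 0) : x ≠ 0 ∨ y ≠ 0 := by
  by_contra hc
  push Not at hc
  exact hxy (by rw [hc.1, hc.2, add_zero])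

/-- Integer bookkeeping for the descent (same signs). [folklore] -/
private theorem natAbs_lt_same {c d : ℤ} (h : (0 < c ∧ 0 < d) ∨ (c < 0 ∧ d < 0)) :
    c.natAbs + d.natAbs < c.natAbs + (c + d).natAbs ∧
    c.natAbs + d.natAbs < d.natAbs + (-c - d).natAbs ∧ c + d ≠ 0 ∧ -c - d ≠ 0 := by
  omega

/-- Integer bookkeeping for the descent (opposite signs). [folklore] -/
private theorem natAbs_lt_opp {c d : ℤ} (h : (0 < c ∧ d < 0) ∨ (c < 0 ∧ 0 < d)) :
    c.natAbs + d.natAbs < (d - c).natAbs + (-d).natAbs ∧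
    c.natAbs + d.natAbs < (-c).natAbs + (c - d).natAbs ∧ d - c ≠ 0 ∧ c - d ≠ 0 ∧ -d ≠ 0 ∧ -c ≠ 0 := by
  omega

/-- Sign dichotomy for two non-zero integers. [folklore] -/
private theorem signs_cases {c d : ℤ} (hc : c ≠ 0) (hd : d ≠ 0) :
    ((0 < c ∧ 0 < d) ∨ (c < 0 ∧ d < 0)) ∨ ((0 < c ∧ d < 0) ∨ (c < 0 ∧ 0 < d)) := by
  omega

/-- **The descent step**: if `a(M) ≠ 0` and both bottom entries of `M` are non-zero, then some `M'`
with the same properties has a strictly larger bottom row (for `cd > 0` use (R'): rows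
`(c, c+d)`, `(d, -c-d)`; for `cd < 0` use (R): rows `(d-c, -d)`, `(-c, c-d)`).
[cite: PopaZagier2017, proof of Lemma 2 and of Thm. 1] -/
theorem exists_rowSize_lt (h : HeckeHyp n ξ) {M : Mat} (hM : M.det ≠ 0) (hc : M 1 0 ≠ 0)
    (hd : M 1 1 ≠ 0) (ha : orbT (zeta0 ξ) M ≠ 0) :
    ∃ M' : Mat, M'.det ≠ 0 ∧ M' 1 0 ≠ 0 ∧ M' 1 1 ≠ 0 ∧ orbT (zeta0 ξ) M' ≠ 0 ∧
      rowSize M < rowSize M' := by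
  obtain ⟨r1, r2, r3, r4, r5, r6, r7, r8⟩ := rows_of_moves M
  have hdS : (M * matS * matU).det ≠ 0 := by simpa [Matrix.det_mul] using hM
  have hdS2 : (M * matS * matU * matU).det ≠ 0 := by simpa [Matrix.det_mul] using hM
  have hdT : (M * matT 1).det ≠ 0 := by simpa [Matrix.det_mul] using hM
  have hdT2 : (M * matT 1 * matS * matU).det ≠ 0 := by simpa [Matrix.det_mul] using hM
  rcases signs_cases hc hd with hsign | hsign
  · -- same signs: relation (R')
    obtain ⟨i1, i2, n1, n2⟩ := natAbs_lt_same hsign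
    rw [h.orbT_zeta0_rel' hM] at ha
    rcases ne_zero_or_of_add_ne_zero (x := orbT (zeta0 ξ) (M * matT 1))
      (y := -orbT (zeta0 ξ) (M * matT 1 * matS * matU)) (by simpa [sub_eq_add_neg] using ha) with h1 | h1
    · refine ⟨M * matT 1, hdT, by rw [r5]; exact hc, by rw [r6]; exact n1, h1, ?_⟩
      simp only [rowSize, r5, r6]
      exact i1
    · refine ⟨M * matT 1 * matS * matU, hdT2, by rw [r7]; exact hd, by rw [r8]; exact n2,
        by simpa using h1, ?_⟩
      simp only [rowSize, r7, r8]
      exact i2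
  · -- opposite signs: relation (R)
    obtain ⟨i1, i2, n1, n2, n3, n4⟩ := natAbs_lt_opp hsign
    rw [h.orbT_zeta0_rel hM] at ha
    rcases ne_zero_or_of_add_ne_zero ha with h1 | h1
    · refine ⟨M * matS * matU, hdS, by rw [r1]; exact n1, by rw [r2]; exact n3, h1, ?_⟩
      simp only [rowSize, r1, r2]
      exact i1
    · refine ⟨M * matS * matU * matU, hdS2, by rw [r3]; exact n4, by rw [r4]; exact n2, h1, ?_⟩
      simp only [rowSize, r3, r4]
      exact i2

/-- **Step 2** ([PopaZagier2017], proof of Thm. 1: "we conclude as in the proof of Lemma 2 that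
`a(K) = 0` unless one of the elements on the second row of matrices in `K` equals `0`"): the
`Γ_∞`-orbit sums of `(1 - S)ξ` vanish at every `M` (of non-zero determinant) whose bottom row has
no zero entry — otherwise the descent step would produce orbits of unbounded row size inside the
finite support. [cite: PopaZagier2017, §3 proof of Thm. 1] -/
theorem orbT_zeta0_eq_zero_of_ne (h : HeckeHyp n ξ) {M : Mat} (hM : M.det ≠ 0) (hc : M 1 0 ≠ 0)
    (hd : M 1 1 ≠ 0) : orbT (zeta0 ξ) M = 0 := by
  obtain ⟨B, hB⟩ := h.exists_rowSize_le
  suffices H : ∀ k : ℕ, ∀ M : Mat, B + 1 - rowSize M = k → M.det ≠ 0 → M 1 0 ≠ 0 → M 1 1 ≠ 0 →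
      orbT (zeta0 ξ) M = 0 from H _ M rfl hM hc hd
  intro k
  induction k using Nat.strong_induction_on with
  | _ k ih =>
    intro M hk hM hc hd
    by_contra ha
    have hle := hB M ha
    obtain ⟨M', hM', hc', hd', ha', hlt⟩ := h.exists_rowSize_lt hM hc hd ha
    have hle' := hB M' ha'
    have hk' : B + 1 - rowSize M' < k := by clear hM hM' ih hB; omega
    exact ha' (ih (B + 1 - rowSize M') hk' M' rfl hM' hc' hd')

/-! ### Conclusion: the orbit sums of `(1 - S)ξ - T_n^∞(1 - S)` vanish -/

/-- The value `a(H) = 1` on upper triangular `H` of determinant `n > 0`, given it on those with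
positive diagonal (evenness handles the negative diagonal). [folklore] -/
theorem orbT_zeta0_eq_one_of_upper (h : HeckeHyp n ξ) (hn : 0 < n)
    (hup : ∀ H : Mat, H.det = n → H 1 0 = 0 → 0 < H 0 0 → orbT (zeta0 ξ) H = 1)
    {H : Mat} (hH : H.det = n) (hc : H 1 0 = 0) : orbT (zeta0 ξ) H = 1 := by
  have had : H 0 0 * H 1 1 = n := by rw [← hH, Matrix.det_fin_two, hc]; ring
  rcases lt_trichotomy (H 0 0) 0 with ha | ha | ha
  · rw [← orbT_neg h.zeta0_neg]
    refine hup (-H) ?_ (by simp [hc]) (by simp only [Matrix.neg_apply]; exact neg_pos.mpr ha)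
    rw [Matrix.det_neg, hH]
    simp
  · exfalso
    rw [ha, zero_mul] at had
    exact hn.ne' had.symm
  · exact hup H hH hc ha

/-- **Property (A) in orbit-sum form.** Let `ξ ∈ ℚ[M_n]` (`n > 0`) be even with property (B), and
suppose `∑_k ζ₀(T^k H) = 1` for every upper triangular `H` of determinant `n` with positive
diagonal (`ζ₀ = (1 - S)ξ`). Then for every `M` of determinant `n`,
`∑_k ζ₀(T^k M) = 𝟙[M₁₀ = 0] - 𝟙[M₁₁ = 0]`. The right-hand side is the `Γ_∞`-orbit-sum function of
`T_n^∞ (1 - S)` (`T_n^∞ = ∑_K M_K` over the upper triangular Hermite representatives `M_K` of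
`Γ \ M_n` together with their negatives: the orbit of `M` contains some `±M_K` iff `M₁₀ = 0`, and
some `±M_K S` iff `M₁₁ = 0`), so this says that all `Γ_∞`-orbit sums of
`(1 - S)ξ - T_n^∞(1 - S)` vanish, i.e. `(1 - S)ξ - T_n^∞(1 - S) ∈ (1 - T)R_n`: property (A) of
[PopaZagier2017] for `ξ` (there: Thm. 1 with `α = 1`). [cite: PopaZagier2017, Thm. 1 and §1 (A)] -/
theorem orbT_zeta0_eq (h : HeckeHyp n ξ) (hn : 0 < n)
    (hup : ∀ H : Mat, H.det = n → H 1 0 = 0 → 0 < H 0 0 → orbT (zeta0 ξ) H = 1)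
    {M : Mat} (hM : M.det = n) :
    orbT (zeta0 ξ) M = (if M 1 0 = 0 then 1 else 0) - (if M 1 1 = 0 then 1 else 0) := by
  have hdet : M.det ≠ 0 := by rw [hM]; exact hn.ne'
  have hrow := row_ne_zero_of_det_ne_zero hdet
  by_cases hc : M 1 0 = 0
  · have hd : M 1 1 ≠ 0 := by tauto
    rw [if_pos hc, if_neg hd, sub_zero]
    exact h.orbT_zeta0_eq_one_of_upper hn hup hM hc
  · by_cases hd : M 1 1 = 0
    · rw [if_neg hc, if_pos hd, zero_sub]
      have h1 := h.orbT_zeta0_add_mul_S hdet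
      have hMS : orbT (zeta0 ξ) (M * matS) = 1 := by
        refine h.orbT_zeta0_eq_one_of_upper hn hup (by simp [Matrix.det_mul, hM]) ?_
        simp [mul_apply_two, hd]
      linear_combination h1 - hMS
    · rw [if_neg hc, if_neg hd, sub_zero]
      exact h.orbT_zeta0_eq_zero_of_ne hdet hc hd

end HeckeHyp

end Literature.NumberTheory.Automorphic.PopaZagier
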